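import Literature.MathematicalPhysics.QuantumFieldTheory.Balaban1983to89.B11TracePairing

/-!
# `Balaban1983to89.B11TracePairingLetters` — the three LETTERS of the transposition bookkeeping for the trace form on
# `U(N)`-matrix-valued bond configurations: DUALITY (`C = 1`) and block HÖLDER (`N ≥ n·#Δ(y)`) for the sup sizes of
# [Balaban1985Variational] (190), and the ADJOINT IDENTITY `⟨Tμ, w⟩ = ⟨μ, Tᵗw⟩` of `B11TracePairing.transposeOf`
# (module 3b of the -b₂ transposition chain `B11Ineq189Transpose` → `…Scalar` → `B11TracePairing` → this file)

statement-level skeleton of published theorems with citation tags; proofs where landed; nothing here is a claim about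
the Yang–Mills mass gap.

CITATION HEADER (lean-in-tree rule 2026-08-18).  [Balaban1985Variational] = T. Bałaban, Commun. Math. Phys. **102** (1985)
277–309: p. 291 (85), (88)–(90) (the scalar products over bonds and the transposed kernels `𝔇*`, `H*`), p. 308 (190) (the sup
sizes *«for x ∈ Δ(y)»*); [Balaban1985Averaging] = T. Bałaban, Commun. Math. Phys. **98** (1985) 17–51: (19) p. 21 (the operator
norm `|·|` on `U(N)`-matrices — Mathlib's scoped `Matrix.Norms.L2Operator`).  Nothing of either paper is asserted: the
displays are the CONTEXT; what is proved is finite-dimensional linear algebra (Hilbert–Schmidt vs operator norm, duality of the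
sup size against the trace form, the adjoint identity of the entrywise transpose).

WHAT IS PROVED (0 def).
* §1 `sum_norm_mulVec_sq_le` (Cauchy–Schwarz per row), **`norm_sq_le_trPair_self`** (`‖A‖² ≤ Re Tr AᴴA`: the operator norm is
  dominated by the Hilbert–Schmidt norm), `abs_re_trace_le` (`|Re Tr M| ≤ n‖M‖`),
  **`trPair_le`** (`Re Tr AᴴB ≤ n‖A‖‖B‖`).
* §2 THE TWO LETTERS for `B11SupSize190.supSize g box blk` with boxes = blocks (`x ∈ box y ↔ blk x = y`, as for
  `B11Ineq73HasMajConcrete.boxS∕boxT`): **`dual_supSize_trForm`** (duality, `C = 1`: witness `δ_x·f(x)∕‖f(x)‖`) and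
  **`holder_supSize_trForm`** (block Hölder, any `N ≥ n·#Δ(y)`).
* §3 **`trForm_transposeOf`** — THE ADJOINT IDENTITY `⟨Tμ, w⟩ = ⟨μ, Tᵗw⟩` (`LinearMap.pi_ext` + `Matrix.induction_on'` + the
  re∕im split of a matrix unit), and `trForm_transposeOf₂` for families.
CONSEQUENCE (stated in words; the one-line instantiation is the consumer's): on `cubeGeometry`'s carriers every hypothesis
of `B11Ineq189Transpose.hasMaj₂_transpose_of_adjoint` ∕ `term189_of_d2D_transpose` is a theorem, with `p₀ = p₃ = trForm`,
`Φᵗ = transposeOf₂ Φ`, `C = 1`, `N = n·#Δ(y)` — e.g. for n07-b's `hasMaj₂_d2_Dfix_concrete` read at `𝔸 = Matrix n n ℂ`.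

HONEST SCOPE.  Theorems only; no `def`, no `instance`, no `notation`; 0 sorry; axioms standard.  One finite T⁴ programme at
fixed `ε` upstream — NOT infinite volume, NOT OS on ℝ⁴, NOT a mass gap, NOT Clay.
-/

namespace Literature.MathematicalPhysics.QuantumFieldTheory.Balaban1983to89.B11TracePairingLetters

open Finset B11SectG B11SupSize190 B11TracePairing
open scoped Matrix ComplexConjugate Matrix.Norms.L2Operator

noncomputable section

variable {n : Type} [Fintype n] [DecidableEq n]

/-! ## §1  Hilbert–Schmidt versus the operator norm of [B7] (19) -/

section Norms

omit [DecidableEq n] in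
/-- Hilbert–Schmidt dominates the operator norm, vector form: `Σ_i ‖(Av)_i‖² ≤ (Σ_{i,j}‖A_{ij}‖²)·Σ_j‖v_j‖²`
(Cauchy–Schwarz in each row). [cite: Balaban1985Averaging, (19) p.21] -/
theorem sum_norm_mulVec_sq_le (A : Matrix n n ℂ) (v : n → ℂ) :
    ∑ i, ‖(A *ᵥ v) i‖ ^ 2 ≤ (∑ i, ∑ j, ‖A i j‖ ^ 2) * ∑ j, ‖v j‖ ^ 2 := by
  rw [Finset.sum_mul]
  refine Finset.sum_le_sum fun i _ => ?_
  have h1 : ‖(A *ᵥ v) i‖ ≤ ∑ j, ‖A i j‖ * ‖v j‖ := by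
    rw [Matrix.mulVec, dotProduct]
    exact (norm_sum_le _ _).trans (le_of_eq (Finset.sum_congr rfl fun j _ => norm_mul _ _))
  have h2 : ∑ j, ‖A i j‖ * ‖v j‖ ≤ √(∑ j, ‖A i j‖ ^ 2) * √(∑ j, ‖v j‖ ^ 2) :=
    Real.sum_mul_le_sqrt_mul_sqrt _ _ _
  have hA : 0 ≤ ∑ j, ‖A i j‖ ^ 2 := Finset.sum_nonneg fun j _ => sq_nonneg _
  have hv : 0 ≤ ∑ j, ‖v j‖ ^ 2 := Finset.sum_nonneg fun j _ => sq_nonneg _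
  calc ‖(A *ᵥ v) i‖ ^ 2 ≤ (√(∑ j, ‖A i j‖ ^ 2) * √(∑ j, ‖v j‖ ^ 2)) ^ 2 :=
        pow_le_pow_left₀ (norm_nonneg _) (h1.trans h2) 2
    _ = (∑ j, ‖A i j‖ ^ 2) * ∑ j, ‖v j‖ ^ 2 := by
        rw [mul_pow, Real.sq_sqrt hA, Real.sq_sqrt hv]

/-- **THE OPERATOR NORM IS DOMINATED BY THE HILBERT–SCHMIDT NORM**: `‖A‖² ≤ Re Tr(AᴴA)` (`‖·‖` = the operator norm on
Euclidean `ℂⁿ`, [Balaban1985Averaging] (19)).  The duality letter's lower bound. [cite: Balaban1985Averaging, (19) p.21] -/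
theorem norm_sq_le_trPair_self (A : Matrix n n ℂ) : ‖A‖ ^ 2 ≤ trPair A A := by
  set S : ℝ := trPair A A with hS
  have hSeq : ∑ i, ∑ j, ‖A i j‖ ^ 2 = S := (trPair_self_eq_sum_sq A).symm
  have hS0 : 0 ≤ S := trPair_self_nonneg A
  have hbound : ∀ x : EuclideanSpace ℂ n,
      ‖Matrix.toEuclideanCLM (n := n) (𝕜 := ℂ) A x‖ ≤ √S * ‖x‖ := by
    intro x
    have hx0 : 0 ≤ √S * ‖x‖ := by positivity
    refine (pow_le_pow_iff_left₀ (norm_nonneg _) hx0 two_ne_zero).mp ?_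
    rw [EuclideanSpace.norm_sq_eq, mul_pow, Real.sq_sqrt hS0, EuclideanSpace.norm_sq_eq, ← hSeq]
    exact sum_norm_mulVec_sq_le A (WithLp.ofLp x)
  have h := ContinuousLinearMap.opNorm_le_bound _ (Real.sqrt_nonneg S) hbound
  rw [← Matrix.cstar_norm_def] at h
  calc ‖A‖ ^ 2 ≤ (√S) ^ 2 := pow_le_pow_left₀ (norm_nonneg _) h 2
    _ = S := Real.sq_sqrt hS0

/-- An entry is bounded by the operator norm: `‖A_{ij}‖ ≤ ‖A‖` (`⟨e_i, Ae_j⟩`).  Private helper — the public statement is already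
in the tree as `Literature.Computability.QuantumComplexity.SolovayKitaev.norm_apply_le_norm` (not imported here to keep the [B11]
chain's closure inside Mathlib + this directory). [folklore] -/
private theorem norm_entry_le_norm (A : Matrix n n ℂ) (i j : n) : ‖A i j‖ ≤ ‖A‖ := by
  have h1 : ‖Matrix.toEuclideanCLM (n := n) (𝕜 := ℂ) A (PiLp.single 2 j (1 : ℂ) : EuclideanSpace ℂ n)‖ ≤ ‖A‖ := by
    refine (ContinuousLinearMap.le_opNorm _ _).trans ?_
    rw [PiLp.norm_single, norm_one, mul_one, Matrix.cstar_norm_def]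
  have h2 : ‖A i j‖ ≤
      ‖Matrix.toEuclideanCLM (n := n) (𝕜 := ℂ) A (PiLp.single 2 j (1 : ℂ) : EuclideanSpace ℂ n)‖ := by
    have hval : (Matrix.toEuclideanCLM (n := n) (𝕜 := ℂ) A (PiLp.single 2 j (1 : ℂ) : EuclideanSpace ℂ n)) i
        = A i j := by
      simp [Matrix.mulVec, dotProduct]
    have h3 := PiLp.norm_apply_le
      (Matrix.toEuclideanCLM (n := n) (𝕜 := ℂ) A (PiLp.single 2 j (1 : ℂ) : EuclideanSpace ℂ n)) i
    rwa [hval] at h3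
  exact h2.trans h1

omit [DecidableEq n] in
/-- `|Re Tr M| ≤ Σ_i ‖M_{ii}‖`. [cite: Balaban1985Averaging, (19) p.21] -/
theorem abs_re_trace_le_sum (M : Matrix n n ℂ) : |M.trace.re| ≤ ∑ i, ‖M i i‖ := by
  rw [Matrix.trace, Complex.re_sum]
  refine (Finset.abs_sum_le_sum_abs _ _).trans (Finset.sum_le_sum fun i _ => ?_)
  exact (Complex.abs_re_le_norm _)

/-- `|Re Tr M| ≤ n·‖M‖`. [cite: Balaban1985Averaging, (19) p.21] -/
theorem abs_re_trace_le (M : Matrix n n ℂ) : |M.trace.re| ≤ Fintype.card n * ‖M‖ := by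
  refine (abs_re_trace_le_sum M).trans ?_
  calc ∑ i, ‖M i i‖ ≤ ∑ _i : n, ‖M‖ := Finset.sum_le_sum fun i _ => norm_entry_le_norm M i i
    _ = Fintype.card n * ‖M‖ := by rw [Finset.sum_const, nsmul_eq_mul, Finset.card_univ]

/-- **THE HÖLDER LETTER AT ONE BOND**: `Re Tr(AᴴB) ≤ n·‖A‖·‖B‖` (trace against the operator norm costs the dimension).
[cite: Balaban1985Averaging, (19) p.21] -/
theorem trPair_le (A B : Matrix n n ℂ) : trPair A B ≤ Fintype.card n * (‖A‖ * ‖B‖) := by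
  unfold trPair
  refine (le_abs_self _).trans ((abs_re_trace_le _).trans ?_)
  refine mul_le_mul_of_nonneg_left ?_ (Nat.cast_nonneg _)
  calc ‖Aᴴ * B‖ ≤ ‖Aᴴ‖ * ‖B‖ := norm_mul_le _ _
    _ = ‖A‖ * ‖B‖ := by rw [Matrix.l2_opNorm_conjTranspose]

end Norms

/-! ## §2  The duality and Hölder letters for the sup sizes of (190) -/

section Letters

variable {g : B6.Geometry} {X : Type} [Fintype X] [DecidableEq X] {box : g.Site → Finset X} {blk : X → g.Site}

/-- **THE DUALITY LETTER, `C = 1`.**  For the sup size of (190) over blocks (`box y` = the points whose block is `y`) on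
`U(N)`-matrix-valued configurations and the trace form: if every test configuration `μ` localised in the block of `y` with
size `≤ 1` has `⟨μ, f⟩ ≤ s`, then the size of `f` at `y` is `≤ s` — witness `μ = δ_x·f(x)∕‖f(x)‖` at the point `x` of the
block, using `‖f(x)‖² ≤ Re Tr f(x)ᴴf(x)` (`norm_sq_le_trPair_self`). [cite: Balaban1985Variational, (190) p.308] -/
theorem dual_supSize_trForm (hbox : ∀ y x, x ∈ box y ↔ blk x = y) (y : g.Site) (f : X → Matrix n n ℂ) (s : ℝ)
    (hs : ∀ μ : X → Matrix n n ℂ, (supSize g box blk : BlockNorm g (X → Matrix n n ℂ)).IsLoc y μ →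
      (supSize g box blk : BlockNorm g (X → Matrix n n ℂ)).loc y μ ≤ 1 → trForm μ f ≤ s) :
    (supSize g box blk : BlockNorm g (X → Matrix n n ℂ)).loc y f ≤ 1 * s := by
  rw [one_mul]
  have hs0 : 0 ≤ s := by
    have h0 := hs 0 (fun _ _ => rfl) (by
      rw [(supSize g box blk : BlockNorm g (X → Matrix n n ℂ)).loc_zero]
      exact zero_le_one)
    rwa [trForm_zero_left] at h0
  refine loc_le_of_forall hs0 fun x hx => ?_
  have hbx : blk x = y := (hbox y x).1 hx
  by_cases hfx : f x = 0
  · rw [hfx, norm_zero]; exact hs0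
  have hpos : 0 < ‖f x‖ := norm_pos_iff.2 hfx
  -- the normalised witness
  set m : Matrix n n ℂ := ((‖f x‖⁻¹ : ℝ) : ℂ) • f x with hm
  have hmnorm : ‖m‖ = 1 := by
    rw [hm, norm_smul, Complex.norm_real, Real.norm_eq_abs, abs_of_pos (inv_pos.2 hpos), inv_mul_cancel₀ hpos.ne']
  have hloc : (supSize g box blk : BlockNorm g (X → Matrix n n ℂ)).IsLoc y (Pi.single x m) := by
    intro x' hx'
    have hne : x' ≠ x := fun h => hx' (h ▸ hbx)
    simp [Pi.single_eq_of_ne hne]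
  have hle1 : (supSize g box blk : BlockNorm g (X → Matrix n n ℂ)).loc y (Pi.single x m) ≤ 1 := by
    refine loc_le_of_forall zero_le_one fun x' _ => ?_
    by_cases h : x' = x
    · subst h; rw [Pi.single_eq_same, hmnorm]
    · rw [Pi.single_eq_of_ne h, norm_zero]; exact zero_le_one
  have key := hs _ hloc hle1
  rw [trForm_single_left, hm, trPair_realSmul_left] at key
  have hsq := norm_sq_le_trPair_self (f x)
  calc ‖f x‖ = ‖f x‖⁻¹ * ‖f x‖ ^ 2 := by field_simp
    _ ≤ ‖f x‖⁻¹ * trPair (f x) (f x) := mul_le_mul_of_nonneg_left hsq (inv_nonneg.2 hpos.le)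
    _ ≤ s := key

omit [DecidableEq X] in
/-- **THE BLOCK HÖLDER LETTER, `N ≥ n·#Δ(y)`.**  A configuration `w` localised in the block of `y` pairs with any `f` to at
most `N·loc_y f·loc_y w` (each of the `#Δ(y)` bonds of the block contributes `Re Tr f(x)ᴴw(x) ≤ n‖f(x)‖‖w(x)‖`, `trPair_le`).
[cite: Balaban1985Variational, (190) p.308] -/
theorem holder_supSize_trForm (hbox : ∀ y x, x ∈ box y ↔ blk x = y) {N : ℝ}
    (hN : ∀ y : g.Site, (Fintype.card n : ℝ) * (box y).card ≤ N) (y : g.Site) (w : X → Matrix n n ℂ)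
    (hw : (supSize g box blk : BlockNorm g (X → Matrix n n ℂ)).IsLoc y w) (f : X → Matrix n n ℂ) :
    trForm f w ≤ N * ((supSize g box blk : BlockNorm g (X → Matrix n n ℂ)).loc y f *
      (supSize g box blk : BlockNorm g (X → Matrix n n ℂ)).loc y w) := by
  set b : BlockNorm g (X → Matrix n n ℂ) := supSize g box blk with hb
  have hzero : ∀ x, x ∉ box y → trPair (f x) (w x) = 0 := fun x hx => by
    rw [hw x (fun h => hx ((hbox y x).2 h)), trPair_zero_right]
  have hsplit : trForm f w = ∑ x ∈ box y, trPair (f x) (w x) := by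
    unfold trForm
    exact (Finset.sum_subset (Finset.subset_univ (box y)) fun x _ hx => hzero x hx).symm
  have hf0 : 0 ≤ b.loc y f := b.loc_nonneg _ _
  have hw0 : 0 ≤ b.loc y w := b.loc_nonneg _ _
  rw [hsplit]
  calc ∑ x ∈ box y, trPair (f x) (w x) ≤ ∑ x ∈ box y, Fintype.card n * (b.loc y f * b.loc y w) := by
        refine Finset.sum_le_sum fun x hx => (trPair_le _ _).trans ?_
        refine mul_le_mul_of_nonneg_left ?_ (Nat.cast_nonneg _)
        have h1 : ‖f x‖ ≤ b.loc y f := by rw [hb, supSize_loc]; exact norm_le_supNorm f hx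
        have h2 : ‖w x‖ ≤ b.loc y w := by rw [hb, supSize_loc]; exact norm_le_supNorm w hx
        exact mul_le_mul h1 h2 (norm_nonneg _) hf0
    _ = (Fintype.card n : ℝ) * (box y).card * (b.loc y f * b.loc y w) := by
        rw [Finset.sum_const, nsmul_eq_mul]; ring
    _ ≤ N * (b.loc y f * b.loc y w) := mul_le_mul_of_nonneg_right (hN y) (mul_nonneg hf0 hw0)

end Letters

/-! ## §3  The adjoint identity of the entrywise transpose -/

section Adjoint

variable {X Y : Type} [DecidableEq X] [Fintype Y]

omit [Fintype n] in
/-- The re∕im split of a matrix unit placed at one bond, as an `ℝ`-linear combination: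
`δ_x(cE_{ij}) = (Re c)·δ_x E_{ij} + (Im c)·δ_x(iE_{ij})`. [folklore] -/
private theorem single_single_eq_re_im (x : X) (i j : n) (c : ℂ) :
    (Pi.single x (Matrix.single i j c) : X → Matrix n n ℂ) =
      c.re • (Pi.single x (Matrix.single i j (1 : ℂ)) : X → Matrix n n ℂ) +
        c.im • (Pi.single x (Matrix.single i j Complex.I) : X → Matrix n n ℂ) := by
  funext x'
  by_cases h : x' = x
  · subst h
    simp only [Pi.add_apply, Pi.smul_apply, Pi.single_eq_same, Matrix.smul_single, ← Matrix.single_add]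
    congr 1
    rw [Complex.real_smul, Complex.real_smul, mul_one, Complex.re_add_im]
  · simp [Pi.single_eq_of_ne h]

variable [Fintype X]

/-- **THE ADJOINT IDENTITY** `⟨Tμ, w⟩ = ⟨μ, Tᵗw⟩` for the trace forms — so `(T, transposeOf T)` is an adjoint pair in the
sense of `B11Ineq189Transpose.hasMaj_transpose_of_adjoint`.  Proof: both sides are `ℝ`-linear in `μ`; by `LinearMap.pi_ext`
and `Matrix.induction_on'` it suffices to test `μ = δ_x(cE_{ij})`, where `⟨δ_x(cE_{ij}), Tᵗw⟩ = Re(conj c·(Tᵗw)(x)_{ij}) =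
(Re c)⟨Tδ_xE_{ij}, w⟩ + (Im c)⟨Tδ_x(iE_{ij}), w⟩ = ⟨T δ_x(cE_{ij}), w⟩`. [cite: Balaban1985Variational, (88) p.291] -/
theorem trForm_transposeOf (T : (X → Matrix n n ℂ) →ₗ[ℝ] (Y → Matrix n n ℂ)) (μ : X → Matrix n n ℂ)
    (w : Y → Matrix n n ℂ) : trForm (T μ) w = trForm μ (transposeOf T w) := by
  have key : (trFormLeft w) ∘ₗ T = trFormLeft (transposeOf T w) := by
    apply LinearMap.pi_ext
    intro x m
    simp only [LinearMap.comp_apply, trFormLeft_apply]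
    rw [trForm_single_left]
    induction m using Matrix.induction_on' with
    | h_zero => rw [Pi.single_zero, map_zero, trForm_zero_left, trPair_zero_left]
    | h_add p q hp hq => rw [Pi.single_add, map_add, trForm_add_left, trPair_add_left, hp, hq]
    | h_std_basis i j c =>
        rw [single_single_eq_re_im, map_add, map_smul, map_smul, trForm_add_left, trForm_smul_left, trForm_smul_left,
          trPair_single_left, transposeOf_apply]
        -- Re(conj c · (a + b i)) = (Re c)·a + (Im c)·b
        simp only [Complex.mul_re, Complex.conj_re, Complex.conj_im, Complex.add_re, Complex.add_im, Complex.ofReal_re,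
          Complex.ofReal_im, Complex.mul_im, Complex.I_re, Complex.I_im]
        ring
  exact LinearMap.congr_fun key μ

variable {FA : Type} [AddCommGroup FA] [Module ℝ FA]

/-- **THE ADJOINT IDENTITY FOR THE FAMILY**: `⟨Φ𝔄μ, w⟩ = ⟨μ, (Φ𝔄)ᵗw⟩` for every `𝔄` — the letter `hadj` of
`B11Ineq189Transpose.hasMaj₂_transpose_of_adjoint`. [cite: Balaban1985Variational, (88) p.291] -/
theorem trForm_transposeOf₂ (Φ : FA →ₗ[ℝ] (X → Matrix n n ℂ) →ₗ[ℝ] (Y → Matrix n n ℂ)) (v : FA) (μ : X → Matrix n n ℂ)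
    (w : Y → Matrix n n ℂ) : trForm (Φ v μ) w = trForm μ (transposeOf₂ Φ v w) :=
  trForm_transposeOf (Φ v) μ w

end Adjoint

end

end Literature.MathematicalPhysics.QuantumFieldTheory.Balaban1983to89.B11TracePairingLetters
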